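import Literature.NumberTheory.Automorphic.MirabolicTower
import HarnessLib

/-!
# The right cosets `Q_{d-1} \ Q_d ≅ K^d ∖ {0}`: representatives `diag(B_η, 1)`

Topic `NumberTheory/Automorphic`; namespace `Literature.NumberTheory.Automorphic`. Over a field `F`
and for `1 ≤ d ≤ n`, the right cosets of `Q_{d-1} = tailUnipotent (d-1)` in `Q_d = tailUnipotent d` are
classified by the low row `lowRow d g ∈ F^d ∖ {0}` (`MirabolicTower`): here we prove that any family of
corner elements `s_η = diag(B_η, 1)`, `B_η ∈ GL_d(F)` with low row `η` (`η ≠ 0`; such `B_η` exist by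
`exists_lowRow_lowCornerGL_eq`), is a **complete system of representatives**:

* `lowRow_ne_zero_of_mem_tailUnipotent` — the low row of `g ∈ Q_d` is non-zero (it is the last row of
  the invertible corner `cornerMatrix d g`);
* `mul_inv_lowCornerGL_mem_tailUnipotent_pred_iff` — for `g ∈ Q_d`: `g s_η⁻¹ ∈ Q_{d-1} ↔ lowRow d g = η`;
* `existsUnique_mul_inv_lowCornerGL_mem` — hence `∃! η ≠ 0, g s_η⁻¹ ∈ Q_{d-1}`.

This is the hypothesis `hs` of the unfolding lemma
`Literature.MeasureTheory.Group.lintegral_mul_eq_lintegral_tsum_mul` for the step `Q_{d-1}(K) ≤ Q_d(K)`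
of the Fourier–Whittaker recursion (Cogdell (2004), proof of Thm. 1.1: "`P_{n-1}(k) \ GL_{n-1}(k) ↔
k^{n-1} ∖ {0}`"). Everything is proved.

## References

* J. W. Cogdell, *Analytic theory of L-functions for GL_n*, in *An Introduction to the Langlands
  Program* (2004), §1.1 [CogdellAnalyticTheory2004].
-/

noncomputable section

open Matrix Set
open scoped MatrixGroups

namespace Literature.NumberTheory.Automorphic

section Field

variable {n : ℕ} {F : Type*} [Field F]

/-- **The low row of an element of `Q_d` is non-zero** (`1 ≤ d ≤ n`): otherwise the row `d-1` of the
invertible corner `cornerMatrix d g` would vanish. [folklore] -/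
theorem lowRow_ne_zero_of_mem_tailUnipotent {d : ℕ} (hd0 : 0 < d) (hdn : d - 1 < n) {g : GL (Fin n) F}
    (hg : g ∈ tailUnipotent n F d) : lowRow d g ≠ 0 := by
  intro h0
  -- the row `d - 1` of `cornerMatrix d g` vanishes
  have hrow : ∀ j : Fin n, cornerMatrix d g ⟨d - 1, hdn⟩ j = 0 := by
    intro j
    rw [cornerMatrix_apply]
    by_cases hj : (j : ℕ) < d
    · rw [if_pos ⟨by simp; omega, hj⟩]
      have := congrFun h0 ⟨j, hj⟩
      unfold lowRow at this
      rw [dif_pos ⟨hd0, hdn⟩] at this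
      exact this
    · rw [if_neg (fun h => hj h.2), if_neg]
      intro he
      have := congrArg Fin.val he
      simp at this
      omega
  have hdet : (cornerMatrix d g).det = 0 := Matrix.det_eq_zero_of_row_eq_zero ⟨d - 1, hdn⟩ hrow
  have hone : (cornerMatrix d g).det * (cornerMatrix d g⁻¹).det = 1 := by
    rw [← Matrix.det_mul, cornerMatrix_mul_cornerMatrix_inv le_rfl hg, Matrix.det_one]
  rw [hdet, zero_mul] at hone
  exact zero_ne_one hone

/-- The corner block of `(diag(B,1))⁻¹ = diag(B⁻¹, 1)` on the low indices. [folklore] -/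
theorem lowCornerGL_inv_apply_low {d : ℕ} (B : GL (ColIdx n d) F) (l j : ColIdx n d) :
    (((lowCornerGL (n := n) (R := F) d B)⁻¹ : GL (Fin n) F) : Matrix (Fin n) (Fin n) F) l.1 j.1 =
      ((B⁻¹ : GL (ColIdx n d) F) : Matrix (ColIdx n d) (ColIdx n d) F) l j := by
  rw [← map_inv, coe_lowCornerGL, lowCornerMatrix_apply, dif_pos l.2, dif_pos j.2]

/-- **`g s_η⁻¹ ∈ Q_{d-1}` iff `lowRow d g = η`**, for `g ∈ Q_d`, `B ∈ GL_d(F)` with low row `η` and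
`s_η = diag(B, 1)` (`1 ≤ d ≤ n`): `lowRow d (g s⁻¹) = lowRow d g · B⁻¹`, and this is `e_{d-1}` iff
`lowRow d g = e_{d-1} B = η`. [folklore] -/
theorem mul_inv_lowCornerGL_mem_tailUnipotent_pred_iff {d : ℕ} (hd0 : 0 < d) (hdn : d - 1 < n)
    {g : GL (Fin n) F} (hg : g ∈ tailUnipotent n F d) {η : ColIdx n d → F} (B : GL (ColIdx n d) F)
    (hB : lowRow d (lowCornerGL (n := n) (R := F) d B) = η) :
    g * (lowCornerGL (n := n) (R := F) d B)⁻¹ ∈ tailUnipotent n F (d - 1) ↔ lowRow d g = η := by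
  classical
  set s := lowCornerGL (n := n) (R := F) d B with hs
  have hsc : s⁻¹ ∈ cornerGL n F d := (cornerGL n F d).inv_mem (lowCornerGL_mem_cornerGL d B)
  have hgs : g * s⁻¹ ∈ tailUnipotent n F d :=
    (tailUnipotent n F d).mul_mem hg (cornerGL_le_tailUnipotent d hsc)
  rw [mem_tailUnipotent_pred_iff hd0 hdn hgs]
  -- `lowRow d (g s⁻¹) = lowRow d g ᵥ* B⁻¹`
  have hvec : lowRow d (g * s⁻¹) = Matrix.vecMul (lowRow d g) ((B⁻¹ : GL (ColIdx n d) F) : Matrix (ColIdx n d) (ColIdx n d) F) := by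
    funext j
    rw [lowRow_mul_of_mem_cornerGL g hsc j, Matrix.vecMul, dotProduct]
    refine Finset.sum_congr rfl fun l _ => ?_
    rw [hs, lowCornerGL_inv_apply_low]
  -- `η = e_{d-1} ᵥ* B`
  have hη : η = Matrix.vecMul (lowStd n d F) ((B : GL (ColIdx n d) F) : Matrix (ColIdx n d) (ColIdx n d) F) := by
    rw [← hB, hs, lowRow_lowCornerGL hd0 hdn]
    funext j
    rw [Matrix.vecMul, dotProduct, Finset.sum_eq_single (⟨⟨d - 1, hdn⟩, by simp; omega⟩ : ColIdx n d)]
    · have : lowStd n d F (⟨⟨d - 1, hdn⟩, by simp; omega⟩ : ColIdx n d) = 1 := by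
        unfold lowStd; rw [if_pos (by simp; omega)]
      rw [this, one_mul]
    · intro l _ hl
      have : lowStd n d F l = 0 := by
        unfold lowStd
        rw [if_neg]
        intro h
        apply hl
        exact Subtype.ext (Fin.ext (by simp; omega))
      rw [this, zero_mul]
    · intro h; exact (h (Finset.mem_univ _)).elim
  rw [hvec]
  constructor
  · intro h
    -- multiply by `B` on the right
    have h2 := congrArg (fun v => Matrix.vecMul v ((B : GL (ColIdx n d) F) : Matrix (ColIdx n d) (ColIdx n d) F)) h
    simp only [Matrix.vecMul_vecMul] at h2
    rw [← Units.val_mul, inv_mul_cancel, Units.val_one, Matrix.vecMul_one] at h2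
    rw [h2, hη]
  · intro h
    rw [h, hη, Matrix.vecMul_vecMul, ← Units.val_mul, mul_inv_cancel, Units.val_one, Matrix.vecMul_one]

/-- **Complete system of representatives of `Q_{d-1} \ Q_d` indexed by `F^d ∖ {0}`**: given, for each
`η ≠ 0`, some `B_η ∈ GL_d(F)` with low row `η`, every `g ∈ Q_d` satisfies `g s_η⁻¹ ∈ Q_{d-1}` for exactly
one `η`, namely `η = lowRow d g` (`s_η = diag(B_η, 1)`). [folklore] -/
theorem existsUnique_mul_inv_lowCornerGL_mem {d : ℕ} (hd0 : 0 < d) (hdn : d - 1 < n)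
    (B : {η : ColIdx n d → F // η ≠ 0} → GL (ColIdx n d) F)
    (hB : ∀ η, lowRow d (lowCornerGL (n := n) (R := F) d (B η)) = η.1)
    {g : GL (Fin n) F} (hg : g ∈ tailUnipotent n F d) :
    ∃! η : {η : ColIdx n d → F // η ≠ 0},
      g * (lowCornerGL (n := n) (R := F) d (B η))⁻¹ ∈ tailUnipotent n F (d - 1) := by
  refine ⟨⟨lowRow d g, lowRow_ne_zero_of_mem_tailUnipotent hd0 hdn hg⟩, ?_, ?_⟩
  · exact (mul_inv_lowCornerGL_mem_tailUnipotent_pred_iff hd0 hdn hg (B _) (hB _)).2 rfl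
  · intro η hη
    have h := (mul_inv_lowCornerGL_mem_tailUnipotent_pred_iff hd0 hdn hg (B η) (hB η)).1 hη
    exact Subtype.ext h.symm

/-- A choice of `B_η` for every `η ≠ 0` (`exists_lowRow_lowCornerGL_eq`). [folklore] -/
def lowCornerChoice {d : ℕ} (hd0 : 0 < d) (hdn : d - 1 < n) (η : {η : ColIdx n d → F // η ≠ 0}) :
    GL (ColIdx n d) F :=
  Classical.choose (exists_lowRow_lowCornerGL_eq (n := n) hd0 hdn η.1 η.2)

/-- The chosen `B_η` has low row `η`. [folklore] -/
theorem lowRow_lowCornerChoice {d : ℕ} (hd0 : 0 < d) (hdn : d - 1 < n) (η : {η : ColIdx n d → F // η ≠ 0}) :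
    lowRow d (lowCornerGL (n := n) (R := F) d (lowCornerChoice hd0 hdn η)) = η.1 :=
  Classical.choose_spec (exists_lowRow_lowCornerGL_eq (n := n) hd0 hdn η.1 η.2)

end Field

end Literature.NumberTheory.Automorphic
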